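import Mathlib
import Summits.Ventures.PercRepro2.HCov
import Summits.Ventures.PercRepro2.A3Fibre
import Summits.Ventures.PercRepro2.A3FibreMain
import Summits.Ventures.PercRepro2.GcInterior
import Summits.Ventures.PercRepro2.GcInteriorPos
import Summits.Ventures.PercRepro2.GcInteriorDo
import Summits.Ventures.PercRepro2.GcRational
import Summits.Ventures.PercRepro2.GcSkelReductionMinH

/-!
# (MEANS-a₃) at interior weights suffices, and `γ ∈ (0, 1]` on the residual
(blind cell PercRepro2, typer-1 g55)

The means-level form `btw` of (HCOV) (`A3Fibre.lean`) divides by the fibre masses `m_W`, by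
`P(Q)` and by `D` (Lean's `x / 0 = 0` on empty fibres), so it is NOT continuous at the boundary
of the cube — but (HCOV) is, and `HCov_of_a3Between` holds at every weight. Hence (MEANS-a₃) at
INTERIOR weights only — where every non-empty fibre has positive mass and `P(Q), D > 0` — gives
the crux:

* `A3Fibre.mW_pos_iff_of_int` — at interior weights a fibre has positive mass iff it is non-empty;
* `A3Fibre.A3Between_int_all`, `A3Fibre.A3BetweenWRedMinH_int_all` — (MEANS-a₃) at interior
  weights, on every graph / on the class of record;
* **`A3Fibre.HCov_all_of_a3Between_int_all`**, **`A3Fibre.HCov_all_of_a3BetweenWRedMinH_int_all`**;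
* `Do_le_PD` (`D_o ≤ D`), **`A3Fibre.gamma_pos_of_wredI`**, **`A3Fibre.gamma_le_one`**: on the
  residual at interior weights `γ = D_o / D ∈ (0, 1]` (`Do_pos_of_wredI`, `PD_pos_of_int`);
* **`WRed.interior_masses_of_wredMinH`** — the lane in one statement: on the class of record at
  interior weights `P(Q)`, `D`, `D_o`, `P(PD, b ∈ U)`, `P(T)`, `P(T′)` are positive and `γ ∈ (0, 1]`
  (with `HCov_all_real_iff_HCovWRedMinH_int_all_rat` of `GcRational.lean`: the crux over `ℝ` is
  (HCOV) on this class at rational interior weights, where all of this holds).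
-/

namespace Summit.Ventures.PercRepro2

open UnionCluster

namespace CovForm

/-! ## `D_o ≤ D` and `γ ∈ (0, 1]` -/

section Gamma

variable {V : Type*} {E : Type*} [Fintype E] [DecidableEq E] {R : Type*} [Field R]
  [LinearOrder R] [IsStrictOrderedRing R]

omit [Fintype E] [DecidableEq E] in
/-- On `PD` the two events `o ∈ C₁`, `o ∈ C₂` are disjoint (`a₁ ↮ a₂` there). -/
lemma disjoint_PD_conn (ends : E → Sym2 V) (o a₁ a₂ a₃ : V) :
    Disjoint (PDEvent ends a₁ a₂ a₃ ∩ connEvent ends a₁ o)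
      (PDEvent ends a₁ a₂ a₃ ∩ connEvent ends a₂ o) := by
  rw [Set.disjoint_left]
  rintro ω ⟨⟨hQ, _⟩, h1⟩ ⟨_, h2⟩
  exact hQ (conn_trans h1 (conn_symm h2))

/-- **`D_o ≤ D`**: `P(PD, o ∈ U) ≤ P(PD)`. -/
lemma Do_le_PD {p : E → R} (hp : IsProbVec p) (ends : E → Sym2 V) (o a₁ a₂ a₃ : V) :
    Do p ends o a₁ a₂ a₃ ≤ prob p (PDEvent ends a₁ a₂ a₃) := by
  unfold Do
  rw [← prob_union_of_disjoint p (disjoint_PD_conn ends o a₁ a₂ a₃)]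
  exact prob_mono hp (fun ω hω => hω.elim (fun h => h.1) (fun h => h.1))

/-- **`γ ≤ 1`** whenever `D > 0`. -/
lemma A3Fibre.gamma_le_one {p : E → R} (hp : IsProbVec p) (ends : E → Sym2 V) (o a₁ a₂ a₃ : V)
    (hD : 0 < prob p (PDEvent ends a₁ a₂ a₃)) : A3Fibre.gamma p ends o a₁ a₂ a₃ ≤ 1 := by
  unfold A3Fibre.gamma
  rw [div_le_one hD]
  exact Do_le_PD hp ends o a₁ a₂ a₃

/-- **`γ > 0` on the residual at interior weights.** -/
theorem A3Fibre.gamma_pos_of_wredI [DecidableEq V] {p : E → R} (hp : IsIntVec p) {ends : E → Sym2 V}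
    {o a₁ a₂ a₃ b : V} (h : WRed.WReducedI ends o a₁ a₂ a₃ b)
    (h12 : a₁ ≠ a₂) (h13 : a₁ ≠ a₃) (h23 : a₂ ≠ a₃) (ho1 : o ≠ a₁) (ho2 : o ≠ a₂) (ho3 : o ≠ a₃)
    (hob : o ≠ b) (hb1 : b ≠ a₁) (hb2 : b ≠ a₂) (hb3 : b ≠ a₃) :
    0 < A3Fibre.gamma p ends o a₁ a₂ a₃ :=
  div_pos (WRed.Do_pos_of_wredI hp h h12 h13 h23 ho1 ho2 ho3 hob hb1 hb2 hb3)
    (PD_pos_of_int hp ends h12 h13 h23)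

end Gamma

/-! ## (MEANS-a₃) at interior weights -/

namespace A3Fibre

section Fibres

variable {V : Type*} {E : Type*} [Fintype E] [DecidableEq E]
  {R : Type*} [Field R] [LinearOrder R] [IsStrictOrderedRing R]

/-- At interior weights a fibre `Q ∩ {C(a₃) = W}` has positive mass iff it is non-empty. -/
theorem mW_pos_iff_of_int {p : E → R} (hp : IsIntVec p) (ends : E → Sym2 V) (a₁ a₂ a₃ : V)
    (W : Finset V) : 0 < mW p ends a₁ a₂ a₃ W ↔ (fibre ends a₁ a₂ a₃ W).Nonempty :=
  prob_pos_iff_of_int hp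

end Fibres

section Closure

variable (R : Type*) [Field R] [LinearOrder R] [IsStrictOrderedRing R]

/-- **(MEANS-a₃) at interior weights for every finite graph.** -/
def A3Between_int_all : Prop :=
  ∀ (V E : Type) [Fintype V] [DecidableEq V] [Fintype E] [DecidableEq E]
    (ends : E → Sym2 V) (p : E → R), IsIntVec p →
    ∀ o a₁ a₂ a₃ b : V, a₁ ≠ a₂ → a₁ ≠ a₃ → a₂ ≠ a₃ → o ≠ a₁ → o ≠ a₂ → o ≠ a₃ → o ≠ b →
      b ≠ a₁ → b ≠ a₂ → b ≠ a₃ → A3Between p ends o a₁ a₂ a₃ b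

/-- **(MEANS-a₃) at interior weights on the class of record.** -/
def A3BetweenWRedMinH_int_all : Prop :=
  ∀ (V E : Type) [Fintype V] [DecidableEq V] [Fintype E] [DecidableEq E]
    (ends : E → Sym2 V) (p : E → R), IsIntVec p →
    ∀ o a₁ a₂ a₃ b : V, a₁ ≠ a₂ → a₁ ≠ a₃ → a₂ ≠ a₃ → o ≠ a₁ → o ≠ a₂ → o ≠ a₃ → o ≠ b →
      b ≠ a₁ → b ≠ a₂ → b ≠ a₃ → WRed.WReducedMinH ends o a₁ a₂ a₃ b →
        A3Between p ends o a₁ a₂ a₃ b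

end Closure

section Main

variable {R : Type*} [Field R] [LinearOrder R] [IsStrictOrderedRing R]

/-- **The crux from (MEANS-a₃) at interior weights**: `A3Between_int_all → HCov_all`. -/
theorem HCov_all_of_a3Between_int_all (h : A3Between_int_all R) : HCov_all R := by
  rw [HCov_all_iff_HCov_int_all]
  intro V E _ _ _ _ ends p hp o a₁ a₂ a₃ b h1 h2 h3 h4 h5 h6 h7 h8 h9 h10
  exact HCov_of_a3Between hp.isProbVec ends o a₁ a₂ a₃ b
    (h V E ends p hp o a₁ a₂ a₃ b h1 h2 h3 h4 h5 h6 h7 h8 h9 h10)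

/-- **The crux from (MEANS-a₃) on the class of record at interior weights**:
`A3BetweenWRedMinH_int_all → HCov_all`. -/
theorem HCov_all_of_a3BetweenWRedMinH_int_all (h : A3BetweenWRedMinH_int_all R) : HCov_all R := by
  rw [WRed.HCov_all_iff_HCovWRedMinH_int_all]
  intro V E _ _ _ _ ends p hp o a₁ a₂ a₃ b h1 h2 h3 h4 h5 h6 h7 h8 h9 h10 hred
  exact HCov_of_a3Between hp.isProbVec ends o a₁ a₂ a₃ b
    (h V E ends p hp o a₁ a₂ a₃ b h1 h2 h3 h4 h5 h6 h7 h8 h9 h10 hred)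

end Main

end A3Fibre

end CovForm

/-! ## The lane in one statement -/

namespace WRed

section Summary

variable {V : Type*} {E : Type*} [Fintype E] [DecidableEq E] [DecidableEq V] {R : Type*}
  [Field R] [LinearOrder R] [IsStrictOrderedRing R]
variable {ends : E → Sym2 V} {o a₁ a₂ a₃ b : V}

/-- **THE INTERIOR-WEIGHTS LANE IN ONE STATEMENT.** On the class of record `WReducedMinH` at
interior weights (`0 < p e < 1`) the masses `P(Q)`, `D = P(PD)`, `D_o = P(PD, o ∈ U)`,
`P(PD, b ∈ U)`, `P(T)`, `P(T′)` are all positive and `γ = D_o / D ∈ (0, 1]`; by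
`HCov_all_real_iff_HCovWRedMinH_int_all_rat` (`GcRational.lean`) the crux over `ℝ` is exactly
(HCOV) on this class at rational interior weights. -/
theorem interior_masses_of_wredMinH {p : E → R} (hp : IsIntVec p)
    (h : WReducedMinH ends o a₁ a₂ a₃ b)
    (h12 : a₁ ≠ a₂) (h13 : a₁ ≠ a₃) (h23 : a₂ ≠ a₃) (ho1 : o ≠ a₁) (ho2 : o ≠ a₂) (ho3 : o ≠ a₃)
    (hob : o ≠ b) (hb1 : b ≠ a₁) (hb2 : b ≠ a₂) (hb3 : b ≠ a₃) :
    0 < prob p (avoidAll ends a₂ {a₁}) ∧ 0 < prob p (PDEvent ends a₁ a₂ a₃) ∧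
      0 < CovForm.Do p ends o a₁ a₂ a₃ ∧ 0 < CovForm.PDb p ends a₁ a₂ a₃ b ∧
      0 < prob p (TEvent ends a₁ a₂ a₃) ∧ 0 < prob p (TEvent ends a₂ a₁ a₃) ∧
      0 < CovForm.A3Fibre.gamma p ends o a₁ a₂ a₃ ∧ CovForm.A3Fibre.gamma p ends o a₁ a₂ a₃ ≤ 1 := by
  have hI := wredI_of_wredMinH h
  obtain ⟨hQ, hD, hT, hT'⟩ := masses_pos_of_wredMinH hp h h12 h13 h23 ho1 ho2 ho3 hob hb1 hb2 hb3
  exact ⟨hQ, hD, Do_pos_of_wredI hp hI h12 h13 h23 ho1 ho2 ho3 hob hb1 hb2 hb3,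
    PDb_pos_of_wredI hp hI h12 h13 h23 ho1 ho2 ho3 hob hb1 hb2 hb3, hT, hT',
    CovForm.A3Fibre.gamma_pos_of_wredI hp hI h12 h13 h23 ho1 ho2 ho3 hob hb1 hb2 hb3,
    CovForm.A3Fibre.gamma_le_one hp.isProbVec ends o a₁ a₂ a₃ hD⟩

end Summary

end WRed

end Summit.Ventures.PercRepro2
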